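import Summits.Ventures.Crystal3D.Bulk.RotSysFaceSdiff
import HarnessLib

/-!
# Deleting one edge from a sub-rotation-system: the faces near the edge AS SETS, and the
# MERGE / SPLIT / pendant identities for the angular excess (generic brick for P-L3(b) L1,
# `phase2/LEAN-FACES-DESIGN.md` §5.6 (i))

HONEST FRAMING. Part of the venture `Summits/Ventures/Crystal3D` (cell `pub-crystal3d`, phase 2;
seat p3), PURELY COMBINATORIAL and generic (folklore): no geometry. Set-level versions of
typer-bulk-2's count lemmas `IsRotSys.numF_sdiff_merge/split` (`Bulk/RotSysDeleteF.lean`): for a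
loopless rotation system `(σ, α)`, an `α`-closed `S ∋ d`, `S₀ = S ∖ {d, α d}`, `φ = phi σ α S`,
`ν = swap d (α d) * φ`, and the set `U = (face d ∪ face (α d)) ∖ {d, α d}`:

* `sameCycle_phi_sdiff_iff_nu` — on `S₀` the faces of `S₀` are the `ν`-cycles;
* **MERGE** (`d`, `α d` on different faces of `S`): `IsRotSys.face_sdiff_eq_U_of_merge` — `U` is
  ONE face of `S₀`; **`IsRotSys.excess_sdiff_merge`** — its excess is
  `excess S d + excess S (α d)`;
* **SPLIT** (`d`, `α d` on the same face of `S`): `U = U₁ ⊔ U₂` with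
  `U₁ = {y ∈ U | ν.SameCycle d y}`, `U₂ = {y ∈ U | ν.SameCycle (α d) y}`, each a face of `S₀` when
  nonempty (`face_sdiff_eq_U₁/U₂`), `U₁ = ∅ ↔ induce σ S (α d) = α d` (the end `α d` is pendant),
  `U₂ = ∅ ↔ induce σ S d = d`; **`IsRotSys.excess_sdiff_split`** — when both are nonempty,
  `excess S₀ q₁ + excess S₀ q₂ = excess S d + 4π`; **`IsRotSys.excess_sdiff_pendant`** — when
  `α d` is pendant and `d` is not, the one face `U₂` has
  `excess S₀ q = excess S d − cornerAt S (α d) + 2π`, where `cornerAt S (α d)` is the full-vertex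
  weight `cornerAt σ w {α d} (α d)`.

These are the three cases of the Gauss–Bonnet induction in `Bulk/RotSysGaussBonnet.lean`.
Nothing here mentions GAP(1.26).
-/

namespace Summit.Ventures.Crystal3D

namespace RotSys

open Equiv Equiv.Perm Finset

open scoped Classical

variable {D : Type*} [DecidableEq D] [Fintype D]
variable {σ α : Perm D} {S : Finset D} {d : D}

/-! ## Faces of `S ∖ e` are `ν`-cycles -/

/-- **On `S ∖ {d, α d}` the face relation of `S ∖ {d, α d}` is the cycle relation of
`ν = swap d (α d) * φ_S`.** -/
theorem IsRotSys.sameCycle_phi_sdiff_iff_nu (h : IsRotSys σ α) (hS : IsClosed α S) (hd : d ∈ S)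
    {x : D} (hx : x ∈ S \ {d, α d}) {y : D} (hy : y ∈ S \ {d, α d}) :
    (phi σ α (S \ {d, α d})).SameCycle x y ↔ (nu σ α S d).SameCycle x y := by
  have hS' : IsClosed α (S \ {d, α d}) := isClosed_sdiff_pair h hS d
  rw [sameCycle_iff_of_eqOn (fun z hz => h.phi_sdiff_eq_induce_nu hS hd hz)
    (fun z hz => phi_apply_mem hS' hz) (fun z hz => induce_apply_mem _ hz) hx y]
  exact sameCycle_induce_iff _ hx hy

/-- The set `U`: the darts of the faces of `d` and of `α d`, other than `d`, `α d`. -/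
theorem mem_U_iff {y : D} :
    y ∈ (face σ α S d ∪ face σ α S (α d)) \ {d, α d} ↔
      y ∈ S \ {d, α d} ∧ ((phi σ α S).SameCycle d y ∨ (phi σ α S).SameCycle (α d) y) := by
  rw [Finset.mem_sdiff, Finset.mem_sdiff, mem_union, mem_face, mem_face]
  tauto

/-! ## MERGE: `d` and `α d` on different faces of `S` -/

/-- **MERGE.** If `d` and `α d` lie on different faces of `S`, then `U` is ONE face of
`S ∖ {d, α d}`: for every `q ∈ U`, `face (S ∖ {d, α d}) q = U`. -/
theorem IsRotSys.face_sdiff_eq_U_of_merge (h : IsRotSys σ α) (hS : IsClosed α S) (hd : d ∈ S)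
    (hdiff : ¬ (phi σ α S).SameCycle d (α d)) {q : D}
    (hq : q ∈ (face σ α S d ∪ face σ α S (α d)) \ {d, α d}) :
    face σ α (S \ {d, α d}) q = (face σ α S d ∪ face σ α S (α d)) \ {d, α d} := by
  obtain ⟨hq', hqc⟩ := mem_U_iff.1 hq
  ext y
  rw [mem_face, mem_U_iff]
  constructor
  · rintro ⟨hy, hc⟩
    refine ⟨hy, ?_⟩
    rw [h.sameCycle_phi_sdiff_iff_nu hS hd hq' hy, nu,
      sameCycle_swap_mul_iff_merge _ hdiff] at hc
    rcases hc with hc | ⟨-, hc⟩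
    · rcases hqc with h1 | h1
      · exact Or.inl (h1.trans hc)
      · exact Or.inr (h1.trans hc)
    · exact hc
  · rintro ⟨hy, hc⟩
    refine ⟨hy, ?_⟩
    rw [h.sameCycle_phi_sdiff_iff_nu hS hd hq' hy, nu, sameCycle_swap_mul_iff_merge _ hdiff]
    exact Or.inr ⟨hqc, hc⟩

/-- In the MERGE case neither end is pendant: `induce σ S d ≠ d` … -/
theorem IsRotSys.induce_ne_self_of_merge (h : IsRotSys σ α)
    (hdiff : ¬ (phi σ α S).SameCycle d (α d)) : induce σ S d ≠ d := by
  intro hfix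
  apply hdiff
  -- `φ (α d) = induce σ S d = d`
  have : phi σ α S (α d) = d := by rw [phi_apply, h.α_inv, hfix]
  exact SameCycle.symm ⟨1, by rw [zpow_one, this]⟩

/-- … and `induce σ S (α d) ≠ α d`. -/
theorem induce_alpha_ne_self_of_merge
    (hdiff : ¬ (phi σ α S).SameCycle d (α d)) : induce σ S (α d) ≠ α d := by
  intro hfix
  apply hdiff
  have : phi σ α S d = α d := by rw [phi_apply, hfix]
  exact ⟨1, by rw [zpow_one, this]⟩

/-- **MERGE, the excess.** If `d` and `α d` lie on different faces of `S`, the face `U` of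
`S ∖ {d, α d}` has excess `excess S d + excess S (α d)`. -/
theorem IsRotSys.excess_sdiff_merge (h : IsRotSys σ α) (hS : IsClosed α S) (hd : d ∈ S)
    (w : D → ℝ) (hdiff : ¬ (phi σ α S).SameCycle d (α d)) {q : D}
    (hq : q ∈ (face σ α S d ∪ face σ α S (α d)) \ {d, α d}) :
    excess σ α w (S \ {d, α d}) q = excess σ α w S d + excess σ α w S (α d) := by
  have hαd : α d ∈ S := hS d hd
  have hne : α d ≠ d := h.α_ne d
  have hU := h.face_sdiff_eq_U_of_merge hS hd hdiff hq
  have hsum := h.sum_cornerAt_sdiff_U hS hd w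
  rw [if_neg (h.induce_ne_self_of_merge hdiff),
    if_neg (induce_alpha_ne_self_of_merge hdiff), sub_zero, sub_zero] at hsum
  -- the two faces of `S` are disjoint
  have hdisj : Disjoint (face σ α S d) (face σ α S (α d)) := by
    rw [Finset.disjoint_left]
    intro y hy hy'
    exact hdiff ((mem_face.1 hy).2.trans (mem_face.1 hy').2.symm)
  have hpair : ({d, α d} : Finset D) ⊆ face σ α S d ∪ face σ α S (α d) := by
    intro x hx
    rw [mem_insert, mem_singleton] at hx
    rcases hx with rfl | rfl
    · exact mem_union_left _ (mem_face_self hd)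
    · exact mem_union_right _ (mem_face_self hαd)
  have hcard : (((face σ α S d ∪ face σ α S (α d)) \ {d, α d}).card : ℝ) =
      (face σ α S d).card + (face σ α S (α d)).card - 2 := by
    rw [Finset.card_sdiff_of_subset hpair, Finset.card_union_of_disjoint hdisj,
      Finset.card_pair hne.symm]
    have : 2 ≤ (face σ α S d).card + (face σ α S (α d)).card := by
      have h1 : 1 ≤ (face σ α S d).card := Finset.card_pos.2 ⟨d, mem_face_self hd⟩
      have h2 : 1 ≤ (face σ α S (α d)).card := Finset.card_pos.2 ⟨α d, mem_face_self hαd⟩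
      omega
    push_cast [Nat.cast_sub this]
    ring
  unfold excess faceSum
  rw [hU, hsum, Finset.sum_union hdisj, hcard]
  ring

/-! ## SPLIT: `d` and `α d` on the same face of `S` -/

section Split

/-- In the SPLIT case a dart of `U` is on the `ν`-cycle of `d` or of `α d`. -/
theorem IsRotSys.nu_sameCycle_or_of_mem_U (h : IsRotSys σ α)
    (hsame : (phi σ α S).SameCycle d (α d)) {y : D}
    (hy : y ∈ (face σ α S d ∪ face σ α S (α d)) \ {d, α d}) :
    (nu σ α S d).SameCycle d y ∨ (nu σ α S d).SameCycle (α d) y := by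
  obtain ⟨-, hc⟩ := mem_U_iff.1 hy
  have hc' : (phi σ α S).SameCycle d y := by
    rcases hc with hc | hc
    · exact hc
    · exact hsame.trans hc
  exact (sameCycle_iff_swap_mul_or _ (h.α_ne d).symm hsame y).1 hc'

/-- In the SPLIT case `d` and `α d` are on different `ν`-cycles. -/
theorem IsRotSys.not_nu_sameCycle_of_split (h : IsRotSys σ α)
    (hsame : (phi σ α S).SameCycle d (α d)) : ¬ (nu σ α S d).SameCycle d (α d) :=
  not_sameCycle_swap_mul_of_sameCycle _ (h.α_ne d).symm hsame

/-- **SPLIT, first part.** For `q ∈ U` on the `ν`-cycle of `d`, the face of `S ∖ {d, α d}`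
through `q` is `U₁ = {y ∈ U | ν.SameCycle d y}`. -/
theorem IsRotSys.face_sdiff_eq_U₁ (h : IsRotSys σ α) (hS : IsClosed α S) (hd : d ∈ S)
    (hsame : (phi σ α S).SameCycle d (α d)) {q : D}
    (hq : q ∈ (face σ α S d ∪ face σ α S (α d)) \ {d, α d}) (hq₁ : (nu σ α S d).SameCycle d q) :
    face σ α (S \ {d, α d}) q =
      ((face σ α S d ∪ face σ α S (α d)) \ {d, α d}).filter
        fun y => (nu σ α S d).SameCycle d y := by
  obtain ⟨hq', -⟩ := mem_U_iff.1 hq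
  ext y
  rw [mem_face, mem_filter, mem_U_iff]
  constructor
  · rintro ⟨hy, hc⟩
    rw [h.sameCycle_phi_sdiff_iff_nu hS hd hq' hy] at hc
    have hdy : (nu σ α S d).SameCycle d y := hq₁.trans hc
    exact ⟨⟨hy, Or.inl ((sameCycle_iff_swap_mul_or _ (h.α_ne d).symm hsame y).2
      (Or.inl hdy))⟩, hdy⟩
  · rintro ⟨⟨hy, -⟩, hdy⟩
    refine ⟨hy, ?_⟩
    rw [h.sameCycle_phi_sdiff_iff_nu hS hd hq' hy]
    exact hq₁.symm.trans hdy

/-- **SPLIT, second part.** For `q ∈ U` on the `ν`-cycle of `α d`, the face of `S ∖ {d, α d}`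
through `q` is `U₂ = {y ∈ U | ν.SameCycle (α d) y}`. -/
theorem IsRotSys.face_sdiff_eq_U₂ (h : IsRotSys σ α) (hS : IsClosed α S) (hd : d ∈ S)
    (hsame : (phi σ α S).SameCycle d (α d)) {q : D}
    (hq : q ∈ (face σ α S d ∪ face σ α S (α d)) \ {d, α d})
    (hq₂ : (nu σ α S d).SameCycle (α d) q) :
    face σ α (S \ {d, α d}) q =
      ((face σ α S d ∪ face σ α S (α d)) \ {d, α d}).filter
        fun y => (nu σ α S d).SameCycle (α d) y := by
  obtain ⟨hq', -⟩ := mem_U_iff.1 hq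
  ext y
  rw [mem_face, mem_filter, mem_U_iff]
  constructor
  · rintro ⟨hy, hc⟩
    rw [h.sameCycle_phi_sdiff_iff_nu hS hd hq' hy] at hc
    have hdy : (nu σ α S d).SameCycle (α d) y := hq₂.trans hc
    exact ⟨⟨hy, Or.inl ((sameCycle_iff_swap_mul_or _ (h.α_ne d).symm hsame y).2
      (Or.inr hdy))⟩, hdy⟩
  · rintro ⟨⟨hy, -⟩, hdy⟩
    refine ⟨hy, ?_⟩
    rw [h.sameCycle_phi_sdiff_iff_nu hS hd hq' hy]
    exact hq₂.symm.trans hdy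

/-- **`U₁` is empty iff the end `α d` is pendant** (`α d` alone at its vertex in `S`). -/
theorem IsRotSys.U₁_eq_empty_iff (h : IsRotSys σ α) (hS : IsClosed α S) (hd : d ∈ S) :
    ((face σ α S d ∪ face σ α S (α d)) \ {d, α d}).filter
        (fun y => (nu σ α S d).SameCycle d y) = ∅ ↔ induce σ S (α d) = α d := by
  have hne : α d ≠ d := h.α_ne d
  -- `ν d = d ↔ φ d = α d ↔ induce σ S (α d) = α d`
  have hνd : nu σ α S d d = d ↔ induce σ S (α d) = α d := by
    rw [nu_apply, ← phi_apply]
    constructor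
    · intro h1
      by_contra h2
      rcases eq_or_ne (phi σ α S d) d with h3 | h3
      · exact h.phi_ne_self S d h3
      · rw [swap_apply_of_ne_of_ne h3 h2] at h1; exact h3 h1
    · intro h1; rw [h1, swap_apply_right]
  rw [← hνd]
  constructor
  · intro hempty
    by_contra hνne
    -- `ν d ∈ U₁`
    have hφd : phi σ α S d ≠ α d := fun e => hνne (by rw [nu_apply, e, swap_apply_right])
    have hνval : nu σ α S d d = phi σ α S d := by
      rw [nu_apply, swap_apply_of_ne_of_ne (h.phi_ne_self S d) hφd]
    have hmem : nu σ α S d d ∈ ((face σ α S d ∪ face σ α S (α d)) \ {d, α d}).filter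
        (fun y => (nu σ α S d).SameCycle d y) := by
      rw [mem_filter, mem_U_iff, hνval]
      refine ⟨⟨mem_sdiff_pair_iff.2 ⟨phi_apply_mem hS hd, h.phi_ne_self S d, hφd⟩,
        Or.inl ⟨1, by rw [zpow_one]⟩⟩, ?_⟩
      rw [← hνval]; exact ⟨1, by rw [zpow_one]⟩
    rw [hempty] at hmem
    exact absurd hmem (Finset.notMem_empty _)
  · intro hfix
    rw [Finset.filter_eq_empty_iff]
    intro y hy hc
    have : y = d := eq_of_sameCycle_of_apply_eq hfix hc
    rw [this] at hy
    exact (mem_sdiff_pair_iff.1 (Finset.mem_sdiff.1 hy |>.1 |> fun hh => Finset.mem_sdiff.2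
      ⟨hh, (Finset.mem_sdiff.1 hy).2⟩)).2.1 rfl

end Split

/-- **`U₂` is empty iff the end `d` is pendant** (`d` alone at its vertex) — the previous lemma
at `α d` (the edge `{α d, α (α d)}` is the same edge). -/
theorem IsRotSys.U₂_eq_empty_iff (h : IsRotSys σ α) (hS : IsClosed α S) (hd : d ∈ S) :
    ((face σ α S d ∪ face σ α S (α d)) \ {d, α d}).filter
        (fun y => (nu σ α S d).SameCycle (α d) y) = ∅ ↔ induce σ S d = d := by
  have hαd : α d ∈ S := hS d hd
  have key := h.U₁_eq_empty_iff hS hαd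
  rw [h.α_inv] at key
  have e1 : (face σ α S (α d) ∪ face σ α S d) \ {α d, d} =
      (face σ α S d ∪ face σ α S (α d)) \ {d, α d} := by
    rw [union_comm, pair_comm]
  have e2 : nu σ α S (α d) = nu σ α S d := by
    unfold nu; rw [h.α_inv, swap_comm]
  rw [e1, e2] at key
  exact key

/-- **SPLIT, the excess (both ends non-pendant).** If `d`, `α d` lie on the same face of `S`,
`q₁ ∈ U` is on the `ν`-cycle of `d` and `q₂ ∈ U` on the `ν`-cycle of `α d`, then
`excess (S ∖ e) q₁ + excess (S ∖ e) q₂ = excess S d + 4π`. -/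
theorem IsRotSys.excess_sdiff_split (h : IsRotSys σ α) (hS : IsClosed α S) (hd : d ∈ S)
    (w : D → ℝ) (hsame : (phi σ α S).SameCycle d (α d)) {q₁ q₂ : D}
    (hq₁ : q₁ ∈ (face σ α S d ∪ face σ α S (α d)) \ {d, α d})
    (hq₁d : (nu σ α S d).SameCycle d q₁)
    (hq₂ : q₂ ∈ (face σ α S d ∪ face σ α S (α d)) \ {d, α d})
    (hq₂α : (nu σ α S d).SameCycle (α d) q₂) :
    excess σ α w (S \ {d, α d}) q₁ + excess σ α w (S \ {d, α d}) q₂ =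
      excess σ α w S d + 4 * Real.pi := by
  have hαd : α d ∈ S := hS d hd
  have hne : α d ≠ d := h.α_ne d
  set U := (face σ α S d ∪ face σ α S (α d)) \ {d, α d} with hU
  set U₁ := U.filter fun y => (nu σ α S d).SameCycle d y with hU₁
  set U₂ := U.filter fun y => (nu σ α S d).SameCycle (α d) y with hU₂
  have hF₁ : face σ α (S \ {d, α d}) q₁ = U₁ := h.face_sdiff_eq_U₁ hS hd hsame hq₁ hq₁d
  have hF₂ : face σ α (S \ {d, α d}) q₂ = U₂ := h.face_sdiff_eq_U₂ hS hd hsame hq₂ hq₂α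
  -- neither end is pendant (the two parts are nonempty)
  have hne₁ : U₁ ≠ ∅ := by rw [← hF₁]; exact Finset.ne_empty_of_mem (mem_face_self (mem_U_iff.1 hq₁).1)
  have hne₂ : U₂ ≠ ∅ := by rw [← hF₂]; exact Finset.ne_empty_of_mem (mem_face_self (mem_U_iff.1 hq₂).1)
  have hnd : induce σ S (α d) ≠ α d := fun e => hne₁ ((h.U₁_eq_empty_iff hS hd).2 e)
  have hnα : induce σ S d ≠ d := fun e => hne₂ ((h.U₂_eq_empty_iff hS hd).2 e)
  -- `U = U₁ ⊔ U₂`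
  have hdisj : Disjoint U₁ U₂ := by
    rw [Finset.disjoint_left]
    intro y hy₁ hy₂
    rw [hU₁, mem_filter] at hy₁
    rw [hU₂, mem_filter] at hy₂
    exact h.not_nu_sameCycle_of_split hsame (hy₁.2.trans hy₂.2.symm)
  have hunion : U₁ ∪ U₂ = U := by
    ext y
    rw [mem_union, hU₁, hU₂, mem_filter, mem_filter]
    constructor
    · rintro (⟨hy, -⟩ | ⟨hy, -⟩) <;> exact hy
    · intro hy
      rcases h.nu_sameCycle_or_of_mem_U hsame hy with hc | hc
      · exact Or.inl ⟨hy, hc⟩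
      · exact Or.inr ⟨hy, hc⟩
  have hsum := h.sum_cornerAt_sdiff_U hS hd w
  rw [if_neg hnα, if_neg hnd, sub_zero, sub_zero, ← hU, ← hunion, Finset.sum_union hdisj] at hsum
  -- cards
  have hface : face σ α S (α d) = face σ α S d := (face_eq_of_sameCycle hsame).symm
  have hpair : ({d, α d} : Finset D) ⊆ face σ α S d := by
    intro x hx
    rw [mem_insert, mem_singleton] at hx
    rcases hx with rfl | rfl
    · exact mem_face_self hd
    · rw [← hface]; exact mem_face_self hαd
  have hcardU : U.card + 2 = (face σ α S d).card := by
    rw [hU, hface, union_idempotent, Finset.card_sdiff_of_subset hpair, Finset.card_pair hne.symm]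
    have : 2 ≤ (face σ α S d).card := by
      rw [← Finset.card_pair hne.symm]; exact Finset.card_le_card hpair
    omega
  have hcard12 : U₁.card + U₂.card = U.card := by
    rw [← Finset.card_union_of_disjoint hdisj, hunion]
  have hC : faceSum σ α w S d = ∑ y ∈ face σ α S d ∪ face σ α S (α d), cornerAt σ w S (α y) := by
    unfold faceSum; rw [hface, union_idempotent]
  unfold excess
  rw [hF₁, hF₂, hC]
  unfold faceSum
  rw [hF₁, hF₂, ← hsum]
  have hcast : ((face σ α S d).card : ℝ) = U₁.card + U₂.card + 2 := by
    rw [← hcardU, ← hcard12]; push_cast; ring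
  rw [hcast]
  ring

/-- **SPLIT with the end `α d` pendant (and `d` not): the excess.** Then `U` is the single face
`U₂` of `S ∖ {d, α d}`, and for `q ∈ U`:
`excess (S ∖ e) q = excess S d − cornerAt S (α d) + 2π`, where `cornerAt S (α d)` is the
full-vertex corner `cornerAt σ w {α d} (α d)`. -/
theorem IsRotSys.excess_sdiff_pendant (h : IsRotSys σ α) (hS : IsClosed α S) (hd : d ∈ S)
    (w : D → ℝ) (hpend : induce σ S (α d) = α d) (hnd : induce σ S d ≠ d) {q : D}
    (hq : q ∈ (face σ α S d ∪ face σ α S (α d)) \ {d, α d}) :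
    excess σ α w (S \ {d, α d}) q =
      excess σ α w S d - cornerAt σ w {α d} (α d) + 2 * Real.pi := by
  have hαd : α d ∈ S := hS d hd
  have hne : α d ≠ d := h.α_ne d
  have hφd : phi σ α S d = α d := by rw [phi_apply, hpend]
  have hsame : (phi σ α S).SameCycle d (α d) := ⟨1, by rw [zpow_one, hφd]⟩
  set U := (face σ α S d ∪ face σ α S (α d)) \ {d, α d} with hU
  -- `U₁ = ∅`, so `q` is on the `ν`-cycle of `α d` and its face is `U₂ = U`
  have hU₁ : U.filter (fun y => (nu σ α S d).SameCycle d y) = ∅ :=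
    (h.U₁_eq_empty_iff hS hd).2 hpend
  have hq₂ : (nu σ α S d).SameCycle (α d) q := by
    rcases h.nu_sameCycle_or_of_mem_U hsame hq with hc | hc
    · exfalso
      have : q ∈ U.filter (fun y => (nu σ α S d).SameCycle d y) := mem_filter.2 ⟨hq, hc⟩
      rw [hU₁] at this
      exact Finset.notMem_empty _ this
    · exact hc
  have hF : face σ α (S \ {d, α d}) q = U := by
    rw [h.face_sdiff_eq_U₂ hS hd hsame hq hq₂]
    ext y
    rw [mem_filter]
    constructor
    · rintro ⟨hy, -⟩; exact hy
    · intro hy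
      rcases h.nu_sameCycle_or_of_mem_U hsame hy with hc | hc
      · exfalso
        have : y ∈ U.filter (fun y => (nu σ α S d).SameCycle d y) := mem_filter.2 ⟨hy, hc⟩
        rw [hU₁] at this
        exact Finset.notMem_empty _ this
      · exact ⟨hy, hc⟩
  have hsum := h.sum_cornerAt_sdiff_U hS hd w
  rw [if_neg hnd, if_pos hpend, sub_zero, ← hU] at hsum
  have hface : face σ α S (α d) = face σ α S d := (face_eq_of_sameCycle hsame).symm
  have hpair : ({d, α d} : Finset D) ⊆ face σ α S d := by
    intro x hx
    rw [mem_insert, mem_singleton] at hx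
    rcases hx with rfl | rfl
    · exact mem_face_self hd
    · rw [← hface]; exact mem_face_self hαd
  have hcardU : U.card + 2 = (face σ α S d).card := by
    rw [hU, hface, union_idempotent, Finset.card_sdiff_of_subset hpair, Finset.card_pair hne.symm]
    have : 2 ≤ (face σ α S d).card := by
      rw [← Finset.card_pair hne.symm]; exact Finset.card_le_card hpair
    omega
  have hC : faceSum σ α w S d = ∑ y ∈ face σ α S d ∪ face σ α S (α d), cornerAt σ w S (α y) := by
    unfold faceSum; rw [hface, union_idempotent]
  have halone : cornerAt σ w S (α d) = cornerAt σ w {α d} (α d) :=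
    cornerAt_eq_cornerAt_singleton_of_alone σ w hαd hpend
  unfold excess
  rw [hF, hC]
  unfold faceSum
  rw [hF, hsum, halone]
  have hcast : ((face σ α S d).card : ℝ) = U.card + 2 := by
    rw [← hcardU]; push_cast; ring
  rw [hcast]
  ring

end RotSys

end Summit.Ventures.Crystal3D
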